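import Summits.ValiantsHypothesis.ValiantsHypothesis.Theorems.LacunarySymmetroidMatrixDescartesWLawTwoChambers

/-!
# `MatrixDescartes` (stmt-ValiantsHypothesis-18050) — the W-law at `n = 2`: SIGN-CELL LAW and the LEVER IDENTITY

HONEST FRAMING.  Cell `pub-symmetroid`, seat `val-sym-mdr-p2` (gen 6); helper `--supports` the crux
`Theses.LacunarySymmetroid.MatrixDescartes` (OPEN), NO closure claim.  Object: the typed W-law of `…WLawDefs` (`WLawAt n B`;
smallest open instance `n = 2`, tree: `6 ≤ w(2) ≤ 8`, and `Z₊ ≤ 6` off the exponent chamber `a < g < c < a + g` by the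
CHAMBER LAW of `…WLawTwoChambers`, val-sym-mdr-p1 g4).  This file adds the SIGN half of the bookkeeping and one typed
MAGNITUDE relation.
* `pivotTwo_posRoots_le_signCell` (any `2 × 2` pivot pencil `X^e J + ∑ₖ X^{dₖ} Pₖ`, `Pₖ ⪰ 0`, `J` any real matrix, no
  `dₖ = e`): a negative coefficient of `det` sits at `2e` only if `det J < 0`, and at `e + dₖ` only if the pairing
  `J₀₀(Pₖ)₁₁ + J₁₁(Pₖ)₀₀ − (J₀₁ + J₁₀)(Pₖ)₀₁` of the pivot with SOME letter of that exponent is negative (`neg_coeff_cases`);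
  so `Z₊ ≤ 2·#T` for any `T` holding those degrees — the tree's `Z₊ ≤ 2K + 2` (conjb-1 g0) refined by pairing signs.
* `wLawTwo_posRoots_le_six_of_offCell`: **`Z₊ ≤ 6 = 3·2` for every `2 × 2` W-configuration with `det J ≥ 0` or with
  `mix(J,P) = J₀₀P₁₁ + J₁₁P₀₀ − 2J₀₁P₀₁ ≥ 0` for at least one letter `P ∈ {P₁, P₂, Q}`** (the sign of `mix` is a congruence
  invariant: in the Minkowski model `Sym₂(ℝ) ≅ ℝ^{1,2}` it is the side of the plane `J^⊥` on which the future-causal `P`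
  lies); with the chamber law, `wLawTwo_posRoots_le_six_unless_hardCell`: **a seventh positive root needs BOTH the chamber
  `a < g < c < a + g` AND the sign cell `det J < 0 ∧ mix(J,P₁) < 0 ∧ mix(J,P₂) < 0 ∧ mix(J,Q) < 0`**.  The tree's six-root
  witness `WLawTwoWitness` is off the cell (`witness_offCell`: `mix(J,P₁) = 202480 > 0`), extremal for this law (`6 = 2·3`).
* `lever_identity` / `lever` (real symmetric `2 × 2` `A, B, Q`): `mix(A,B)·mix(A,Q) − det(A)·mix(B,Q) = tr(adj A·B·adj A·Q)`,
  hence `det(A)·mix(B,Q) ≤ mix(A,B)·mix(A,Q)` for `B, Q ⪰ 0` (stated for PSD `A` in the eigenbasis by val-sym-mdr-p1 g4,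
  WLAW-N2-CHAMBERS.md §3, untyped; the identity names the slack and frees `A`).  With `A = P₁` it is the relation
  `c_{2g}·c_k ≤ c_g·c_{g+k}` among the positive coefficients `det P₁, mix(P₂,Q), mix(P₁,P₂), mix(P₁,Q)` of the W-determinant
  at degrees `2g, k, g, g + k` (`d₂ = 0`): in the open chamber (`g < 2g < k < g + k`) the INNER pair is dominated by the
  OUTER pair — the anti-Newton instance that forbids the Descartes pattern `+ + − + − + − + − +` under scale separation
  (the separators `X^{2g}`, `X^k` cannot both dominate).  Typed as the magnitude input a proof in the hard cell must use.
Nothing here decides the hard cell (chamber ∧ sign cell: signs allow `8`, located `≤ 6`); nothing bears on `WLaw` for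
`n ≥ 3`, on `MatrixDescartes` / `stub_twoSided` in its window, `DoorA26` / `DoorA34`, registers, or `VP ≠ VNP`.

[folklore] Descartes' rule of signs with a negative-support budget (tree `Pivot.TwoDescartes.card_posRoots_le_two_mul_card`),
mixed discriminants of PSD `2 × 2` matrices, a `2 × 2` adjugate identity checked by `ring`; no source.
-/

-- `Summit.ValiantsHypothesis.ValiantsHypothesis.…` repeats a component by the D-0017 layout
-- (single-conjunct summit), which the `dupNamespace` linter flags; the name is mandated.
set_option linter.dupNamespace false

namespace Summit.ValiantsHypothesis.ValiantsHypothesis.Theorems.LacunarySymmetroidMatrixDescartes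

open Polynomial Finset
open scoped BigOperators

namespace WLawTwoSignCell

/-! ## 1. The lever identity and the lever inequality -/

section Lever

/-- **LEVER IDENTITY** (real symmetric `2 × 2` matrices `A, B, Q`):
`mix(A,B)·mix(A,Q) − det(A)·mix(B,Q) = tr(adj(A)·B·adj(A)·Q)`, where `mix(X,Y) = X₀₀Y₁₁ + X₁₁Y₀₀ − 2X₀₁Y₀₁` is the
polarised determinant (`det(X + Y) = det X + mix(X,Y) + det Y`). [folklore] -/
theorem lever_identity (A B Q : Matrix (Fin 2) (Fin 2) ℝ) (hA : A 1 0 = A 0 1) (hB : B 1 0 = B 0 1)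
    (hQ : Q 1 0 = Q 0 1) :
    (A 0 0 * B 1 1 + A 1 1 * B 0 0 - 2 * (A 0 1 * B 0 1)) * (A 0 0 * Q 1 1 + A 1 1 * Q 0 0 - 2 * (A 0 1 * Q 0 1))
        - A.det * (B 0 0 * Q 1 1 + B 1 1 * Q 0 0 - 2 * (B 0 1 * Q 0 1))
      = Matrix.trace (A.adjugate * B * A.adjugate * Q) := by
  rw [Matrix.trace_fin_two, Matrix.adjugate_fin_two, Matrix.det_fin_two]
  simp only [Matrix.mul_apply, Fin.sum_univ_two, Matrix.of_apply, Matrix.cons_val', Matrix.cons_val_zero,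
    Matrix.cons_val_one, Matrix.empty_val', Matrix.cons_val_fin_one]
  rw [hA, hB, hQ]
  ring

/-- For real symmetric `A` and `B ⪰ 0`, the sandwich `adj(A)·B·adj(A)` is positive semidefinite. [folklore] -/
theorem adjugate_sandwich_posSemidef (A B : Matrix (Fin 2) (Fin 2) ℝ) (hA : A.IsSymm) (hB : B.PosSemidef) :
    (A.adjugate * B * A.adjugate).PosSemidef := by
  have h1 : (A.adjugate).conjTranspose = A.adjugate := by
    rw [Matrix.conjTranspose_eq_transpose_of_trivial, Matrix.adjugate_transpose, hA.eq]
  have h2 := hB.conjTranspose_mul_mul_same A.adjugate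
  rwa [h1] at h2

/-- The trace of a product of two PSD real `2 × 2` matrices is nonnegative. [folklore] -/
theorem trace_mul_nonneg_two {M Q : Matrix (Fin 2) (Fin 2) ℝ} (hM : M.PosSemidef) (hQ : Q.PosSemidef) :
    0 ≤ Matrix.trace (M * Q) := by
  obtain ⟨hM0, hM1, hMs, hMd⟩ := Pivot.TwoDescartes.psd_two_facts hM
  obtain ⟨hQ0, hQ1, hQs, hQd⟩ := Pivot.TwoDescartes.psd_two_facts hQ
  rw [Matrix.trace_fin_two]
  simp only [Matrix.mul_apply, Fin.sum_univ_two]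
  rw [hMs, hQs]
  have h := Pivot.TwoDescartes.mixedDisc_nonneg (M 0 0) (-M 0 1) (M 1 1) (Q 1 1) (Q 0 1) (Q 0 0) hM0 hM1 hQ1 hQ0
    (by rw [neg_mul_neg]; exact hMd) (by linarith)
  linarith

/-- **LEVER INEQUALITY**: for real symmetric `A` and `B, Q ⪰ 0`, `det(A)·mix(B,Q) ≤ mix(A,B)·mix(A,Q)`.
For the W-pencil with middle letter `A = P₁` these are the positive coefficients of `det F` at `2g, k` (inner) and
`g, g + k` (outer): the inner pair is dominated by the outer pair. [folklore] -/
theorem lever (A B Q : Matrix (Fin 2) (Fin 2) ℝ) (hA : A.IsSymm) (hB : B.PosSemidef) (hQ : Q.PosSemidef) :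
    A.det * (B 0 0 * Q 1 1 + B 1 1 * Q 0 0 - 2 * (B 0 1 * Q 0 1))
      ≤ (A 0 0 * B 1 1 + A 1 1 * B 0 0 - 2 * (A 0 1 * B 0 1)) * (A 0 0 * Q 1 1 + A 1 1 * Q 0 0 - 2 * (A 0 1 * Q 0 1)) := by
  have hAs : A 1 0 = A 0 1 := hA.apply 0 1
  have hBs : B 1 0 = B 0 1 := (Pivot.TwoDescartes.psd_two_facts hB).2.2.1
  have hQs : Q 1 0 = Q 0 1 := (Pivot.TwoDescartes.psd_two_facts hQ).2.2.1
  have hid := lever_identity A B Q hAs hBs hQs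
  have hpsd := adjugate_sandwich_posSemidef A B hA hB
  have htr := trace_mul_nonneg_two hpsd hQ
  linarith

end Lever

/-! ## 2. The `2 × 2` pivot pencil: where a negative coefficient can sit, refined by the pivot pairing -/

section Pencil

open Pivot.TwoDescartes (letter expo agg coeff_det agg_eq_zero agg_posSemidef psd_two_facts mixedDisc_nonneg
  pencil_eq_sum card_posRoots_le_two_mul_card coeff_det_nonneg_of_not_mem)

variable {K : ℕ}

/-- With no PSD letter at the pivot exponent, the aggregated letter at `e` is the pivot `J`. -/
theorem agg_pivot (e : ℕ) (d : Fin K → ℕ) (J : Matrix (Fin 2) (Fin 2) ℝ) (P : Fin K → Matrix (Fin 2) (Fin 2) ℝ)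
    (hd : ∀ k, d k ≠ e) : agg e d J P e = J := by
  unfold agg
  rw [Fintype.sum_option]
  have h1 : (if expo e d none = e then letter J P none else 0) = J := if_pos rfl
  have h2 : ∀ k : Fin K, (if expo e d (some k) = e then letter J P (some k) else 0) = 0 :=
    fun k => if_neg (hd k)
  rw [h1, Finset.sum_congr rfl fun k _ => h2 k]
  simp

/-- Away from the pivot exponent, the aggregated letter is the sum of the PSD letters of that exponent. -/
theorem agg_of_ne (e : ℕ) (d : Fin K → ℕ) (J : Matrix (Fin 2) (Fin 2) ℝ) (P : Fin K → Matrix (Fin 2) (Fin 2) ℝ)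
    (b : ℕ) (hb : b ≠ e) : agg e d J P b = ∑ k, if d k = b then P k else 0 := by
  unfold agg
  rw [Fintype.sum_option]
  have h1 : (if expo e d none = b then letter J P none else 0) = 0 :=
    if_neg (fun h => hb (show e = b from h).symm)
  rw [h1, zero_add]
  rfl

/-- Entries of the aggregated letter away from the pivot. -/
theorem agg_of_ne_apply (e : ℕ) (d : Fin K → ℕ) (J : Matrix (Fin 2) (Fin 2) ℝ) (P : Fin K → Matrix (Fin 2) (Fin 2) ℝ)
    (b : ℕ) (hb : b ≠ e) (i j : Fin 2) : agg e d J P b i j = ∑ k, if d k = b then P k i j else 0 := by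
  rw [agg_of_ne e d J P b hb, Matrix.sum_apply]
  refine Finset.sum_congr rfl fun k _ => ?_
  split_ifs <;> rfl

/-- The summand of `coeff_det`, symmetrised over the swap, is nonnegative on pairs of non-pivot exponents. -/
theorem pair_nonneg (e : ℕ) (d : Fin K → ℕ) (J : Matrix (Fin 2) (Fin 2) ℝ) (P : Fin K → Matrix (Fin 2) (Fin 2) ℝ)
    (hP : ∀ k, (P k).PosSemidef) (a b : ℕ) (ha : a ≠ e) (hb : b ≠ e) :
    0 ≤ (agg e d J P a 0 0 * agg e d J P b 1 1 - agg e d J P a 0 1 * agg e d J P b 1 0)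
        + (agg e d J P b 0 0 * agg e d J P a 1 1 - agg e d J P b 0 1 * agg e d J P a 1 0) := by
  obtain ⟨hA0, hA1, hAs, hAd⟩ := psd_two_facts (agg_posSemidef e d J P hP a ha)
  obtain ⟨hB0, hB1, hBs, hBd⟩ := psd_two_facts (agg_posSemidef e d J P hP b hb)
  rw [hAs, hBs]
  have := mixedDisc_nonneg _ _ _ _ _ _ hA0 hA1 hB0 hB1 hAd hBd
  linarith

/-- The part of the coefficient sum over pairs avoiding the pivot exponent is nonnegative. -/
theorem sum_offPivot_nonneg (e : ℕ) (d : Fin K → ℕ) (J : Matrix (Fin 2) (Fin 2) ℝ)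
    (P : Fin K → Matrix (Fin 2) (Fin 2) ℝ) (hP : ∀ k, (P k).PosSemidef) (n : ℕ) :
    0 ≤ ∑ x ∈ (antidiagonal n).filter (fun x => ¬ (x.1 = e ∨ x.2 = e)),
        (agg e d J P x.1 0 0 * agg e d J P x.2 1 1 - agg e d J P x.1 0 1 * agg e d J P x.2 1 0) := by
  rw [Finset.sum_filter]
  set f : ℕ × ℕ → ℝ := fun x => if ¬ (x.1 = e ∨ x.2 = e) then
    (agg e d J P x.1 0 0 * agg e d J P x.2 1 1 - agg e d J P x.1 0 1 * agg e d J P x.2 1 0) else 0 with hf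
  change 0 ≤ ∑ x ∈ antidiagonal n, f x
  have hswap : ∑ x ∈ antidiagonal n, f x.swap = ∑ x ∈ antidiagonal n, f x :=
    Finset.Nat.sum_antidiagonal_swap
  have h2 : 2 * ∑ x ∈ antidiagonal n, f x = ∑ x ∈ antidiagonal n, (f x + f x.swap) := by
    rw [Finset.sum_add_distrib, hswap, two_mul]
  suffices hpair : ∀ x ∈ antidiagonal n, 0 ≤ f x + f x.swap by
    have := Finset.sum_nonneg hpair
    linarith
  intro x _
  obtain ⟨a, b⟩ := x
  simp only [hf, Prod.swap_prod_mk]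
  by_cases h : a = e ∨ b = e
  · have h' : b = e ∨ a = e := h.symm
    rw [if_neg (not_not.mpr h), if_neg (not_not.mpr h'), add_zero]
  · have h' : ¬ (b = e ∨ a = e) := fun hh => h hh.symm
    rw [if_pos h, if_pos h']
    push Not at h
    exact pair_nonneg e d J P hP a b h.1 h.2

/-- **Refined sign lemma, pivot square**: with no PSD letter at the pivot exponent, the coefficient of `X^{2e}` in
`det F` is at least `det J`. -/
theorem det_le_coeff_two_pivot (e : ℕ) (d : Fin K → ℕ) (J : Matrix (Fin 2) (Fin 2) ℝ)
    (P : Fin K → Matrix (Fin 2) (Fin 2) ℝ) (hP : ∀ k, (P k).PosSemidef) (hd : ∀ k, d k ≠ e) :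
    J.det ≤ (Matrix.det (∑ l, ((X : ℝ[X]) ^ expo e d l) • (letter J P l).map Polynomial.C)).coeff (e + e) := by
  rw [coeff_det]
  rw [← Finset.sum_filter_add_sum_filter_not (antidiagonal (e + e)) (fun x => x.1 = e ∨ x.2 = e)]
  have hS1 : (antidiagonal (e + e)).filter (fun x => x.1 = e ∨ x.2 = e) = {(e, e)} := by
    ext ⟨a, b⟩
    simp only [Finset.mem_filter, Finset.HasAntidiagonal.mem_antidiagonal, Finset.mem_singleton, Prod.mk.injEq]
    omega
  rw [hS1, Finset.sum_singleton]
  have h0 := sum_offPivot_nonneg e d J P hP (e + e)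
  simp only at h0 ⊢
  rw [agg_pivot e d J P hd, Matrix.det_fin_two]
  linarith

/-- **Refined sign lemma, pivot cross terms**: with no PSD letter at the pivot exponent and `b ≠ e`, the coefficient
of `X^{e+b}` in `det F` is at least the pivot pairing `J₀₀A₁₁ + J₁₁A₀₀ − (J₀₁ + J₁₀)A₀₁` of `J` with the aggregated
PSD letter `A` of exponent `b`. -/
theorem pairing_le_coeff_pivot_add (e : ℕ) (d : Fin K → ℕ) (J : Matrix (Fin 2) (Fin 2) ℝ)
    (P : Fin K → Matrix (Fin 2) (Fin 2) ℝ) (hP : ∀ k, (P k).PosSemidef) (hd : ∀ k, d k ≠ e) (b : ℕ) (hb : b ≠ e) :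
    J 0 0 * agg e d J P b 1 1 + J 1 1 * agg e d J P b 0 0 - (J 0 1 + J 1 0) * agg e d J P b 0 1
      ≤ (Matrix.det (∑ l, ((X : ℝ[X]) ^ expo e d l) • (letter J P l).map Polynomial.C)).coeff (e + b) := by
  rw [coeff_det]
  rw [← Finset.sum_filter_add_sum_filter_not (antidiagonal (e + b)) (fun x => x.1 = e ∨ x.2 = e)]
  have hS1 : (antidiagonal (e + b)).filter (fun x => x.1 = e ∨ x.2 = e) = {(e, b), (b, e)} := by
    ext ⟨a, c⟩
    simp only [Finset.mem_filter, Finset.HasAntidiagonal.mem_antidiagonal, Finset.mem_insert, Finset.mem_singleton,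
      Prod.mk.injEq]
    omega
  have hne : (e, b) ≠ (b, e) := by
    intro h
    simp only [Prod.mk.injEq] at h
    exact hb h.1.symm
  rw [hS1, Finset.sum_pair hne]
  have h0 := sum_offPivot_nonneg e d J P hP (e + b)
  simp only at h0 ⊢
  have hAs : agg e d J P b 1 0 = agg e d J P b 0 1 := (psd_two_facts (agg_posSemidef e d J P hP b hb)).2.2.1
  rw [agg_pivot e d J P hd, hAs]
  linarith

/-- **Where a negative coefficient can sit.**  For a `2 × 2` pivot pencil `X^e J + ∑ₖ X^{dₖ} Pₖ` (`Pₖ ⪰ 0`, no `dₖ`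
equal to `e`, `J` any real matrix): a negative coefficient of `det` sits at `2e` with `det J < 0`, or at `e + dₖ` for
a letter `Pₖ` whose pairing `J₀₀(Pₖ)₁₁ + J₁₁(Pₖ)₀₀ − (J₀₁ + J₁₀)(Pₖ)₀₁` with the pivot is negative. -/
theorem neg_coeff_cases (e : ℕ) (d : Fin K → ℕ) (J : Matrix (Fin 2) (Fin 2) ℝ)
    (P : Fin K → Matrix (Fin 2) (Fin 2) ℝ) (hP : ∀ k, (P k).PosSemidef) (hd : ∀ k, d k ≠ e) (n : ℕ)
    (hn : (Matrix.det (∑ l, ((X : ℝ[X]) ^ expo e d l) • (letter J P l).map Polynomial.C)).coeff n < 0) :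
    (n = e + e ∧ J.det < 0) ∨
      ∃ k, n = e + d k ∧ J 0 0 * P k 1 1 + J 1 1 * P k 0 0 - (J 0 1 + J 1 0) * P k 0 1 < 0 := by
  classical
  -- a negative coefficient sits at `e + expo l` for some letter `l`
  have hex : ∃ l, e + expo e d l = n := by
    by_contra hnot
    push Not at hnot
    exact absurd hn (not_lt.mpr (coeff_det_nonneg_of_not_mem e d J P hP n hnot))
  obtain ⟨l, hl⟩ := hex
  rcases l with _ | k
  · -- the pivot square
    left
    have hl' : n = e + e := by rw [← hl]; rfl
    refine ⟨hl', ?_⟩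
    have h := det_le_coeff_two_pivot e d J P hP hd
    rw [← hl'] at h
    linarith
  · -- a cross term with the letters of exponent `d k`
    right
    have hl' : n = e + d k := by rw [← hl]; rfl
    have hb : d k ≠ e := hd k
    have h := pairing_le_coeff_pivot_add e d J P hP hd (d k) hb
    rw [← hl'] at h
    have hneg : J 0 0 * agg e d J P (d k) 1 1 + J 1 1 * agg e d J P (d k) 0 0
        - (J 0 1 + J 1 0) * agg e d J P (d k) 0 1 < 0 := by linarith
    -- linearity of the pairing in the aggregated letter
    rw [agg_of_ne_apply e d J P (d k) hb, agg_of_ne_apply e d J P (d k) hb, agg_of_ne_apply e d J P (d k) hb,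
      Finset.mul_sum, Finset.mul_sum, Finset.mul_sum, ← Finset.sum_add_distrib, ← Finset.sum_sub_distrib] at hneg
    by_contra hall
    push Not at hall
    refine absurd hneg (not_lt.mpr (Finset.sum_nonneg fun k' _ => ?_))
    by_cases hk' : d k' = d k
    · simp only [hk', if_true]
      have := hall k' (by rw [hk', hl'])
      linarith
    · simp only [hk', if_false, mul_zero, add_zero, sub_zero]
      exact le_refl _

/-- **SIGN-CELL LAW for `2 × 2` pivot pencils.**  If `T` contains `2e` whenever `det J < 0` and contains `e + dₖ` for
every letter with a negative pivot pairing, then `det F` has at most `2 · #T` distinct positive roots.  (With `T` = all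
`K + 1` pivot degrees this is the tree's `Z₊ ≤ 2K + 2`.) -/
theorem pivotTwo_posRoots_le_signCell (e : ℕ) (d : Fin K → ℕ) (J : Matrix (Fin 2) (Fin 2) ℝ)
    (P : Fin K → Matrix (Fin 2) (Fin 2) ℝ) (hP : ∀ k, (P k).PosSemidef) (hd : ∀ k, d k ≠ e) (T : Finset ℕ)
    (hTJ : J.det < 0 → e + e ∈ T)
    (hTP : ∀ k, J 0 0 * P k 1 1 + J 1 1 * P k 0 0 - (J 0 1 + J 1 0) * P k 0 1 < 0 → e + d k ∈ T) :
    ((Matrix.det (((X : ℝ[X]) ^ e) • J.map Polynomial.C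
        + ∑ k, ((X : ℝ[X]) ^ d k) • (P k).map Polynomial.C)).roots.toFinset.filter (fun t => 0 < t)).card
      ≤ 2 * T.card := by
  rw [pencil_eq_sum]
  refine card_posRoots_le_two_mul_card _ T fun n hn => ?_
  rcases neg_coeff_cases e d J P hP hd n hn with ⟨hne, hJ⟩ | ⟨k, hnk, hk⟩
  · rw [hne]; exact hTJ hJ
  · rw [hnk]; exact hTP k hk

end Pencil

/-! ## 3. The W-pencil at `n = 2`: `Z₊ ≤ 6` off the sign cell -/

section WPencil

variable {e d₁ d₂ d₃ : ℕ} {J P₁ P₂ Q : Matrix (Fin 2) (Fin 2) ℝ}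

/-- PSD-ness of the three letters as a function on `Fin 3`. -/
theorem psd_letters (hP₁ : P₁.PosSemidef) (hP₂ : P₂.PosSemidef) (hQ : Q.PosSemidef) :
    ∀ k : Fin 3, ((![P₁, P₂, Q] : Fin 3 → Matrix (Fin 2) (Fin 2) ℝ) k).PosSemidef := by
  intro k
  fin_cases k
  · simpa using hP₁
  · simpa using hP₂
  · simpa using hQ

/-- **SIGN-CELL LAW for the W-pencil (`Z₊ ≤ 6` off the cell).**  A `2 × 2` W-configuration
`X^e J + X^{d₁} P₁ + X^{d₂} P₂ + X^{d₃} Q` (`d₂ < d₁ < e < d₃`, `J` symmetric, `P₁, P₂, Q ⪰ 0`) with `det J ≥ 0`, or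
with `mix(J,P) = J₀₀P₁₁ + J₁₁P₀₀ − 2J₀₁P₀₁ ≥ 0` for at least one letter `P ∈ {P₁, P₂, Q}`, has at most `6 = 3·2` distinct
positive roots of its determinant. -/
theorem wLawTwo_posRoots_le_six_of_offCell (hJ : J.IsSymm) (hP₁ : P₁.PosSemidef) (hP₂ : P₂.PosSemidef)
    (hQ : Q.PosSemidef) (h₂₁ : d₂ < d₁) (h₁ₑ : d₁ < e) (hₑ₃ : e < d₃)
    (hcell : 0 ≤ J.det ∨ 0 ≤ J 0 0 * P₁ 1 1 + J 1 1 * P₁ 0 0 - 2 * (J 0 1 * P₁ 0 1)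
      ∨ 0 ≤ J 0 0 * P₂ 1 1 + J 1 1 * P₂ 0 0 - 2 * (J 0 1 * P₂ 0 1)
      ∨ 0 ≤ J 0 0 * Q 1 1 + J 1 1 * Q 0 0 - 2 * (J 0 1 * Q 0 1)) :
    ((Matrix.det (((X : ℝ[X]) ^ e) • J.map Polynomial.C + ((X : ℝ[X]) ^ d₁) • P₁.map Polynomial.C
        + ((X : ℝ[X]) ^ d₂) • P₂.map Polynomial.C + ((X : ℝ[X]) ^ d₃) • Q.map Polynomial.C)).roots.toFinset.filter
          (fun t => 0 < t)).card ≤ 6 := by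
  rw [WLawTwoChambers.wPencil_eq]
  have hP := psd_letters hP₁ hP₂ hQ
  have hd : ∀ k : Fin 3, (![d₁, d₂, d₃] : Fin 3 → ℕ) k ≠ e := by
    intro k
    fin_cases k <;> simp <;> omega
  have hJs : J 0 1 + J 1 0 = 2 * J 0 1 := by rw [hJ.apply 0 1]; ring
  -- the pairing of `J` with letter `k`, in the symmetric form
  have hpair : ∀ k : Fin 3,
      J 0 0 * (![P₁, P₂, Q] : Fin 3 → Matrix (Fin 2) (Fin 2) ℝ) k 1 1
        + J 1 1 * (![P₁, P₂, Q] : Fin 3 → Matrix (Fin 2) (Fin 2) ℝ) k 0 0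
        - (J 0 1 + J 1 0) * (![P₁, P₂, Q] : Fin 3 → Matrix (Fin 2) (Fin 2) ℝ) k 0 1
      = J 0 0 * (![P₁, P₂, Q] : Fin 3 → Matrix (Fin 2) (Fin 2) ℝ) k 1 1
        + J 1 1 * (![P₁, P₂, Q] : Fin 3 → Matrix (Fin 2) (Fin 2) ℝ) k 0 0
        - 2 * (J 0 1 * (![P₁, P₂, Q] : Fin 3 → Matrix (Fin 2) (Fin 2) ℝ) k 0 1) := by
    intro k; rw [hJs]; ring
  have card3 : ∀ a b c : ℕ, (({a, b, c} : Finset ℕ)).card ≤ 3 := fun a b c =>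
    (Finset.card_insert_le _ _).trans (Nat.succ_le_succ ((Finset.card_insert_le _ _).trans
      (by rw [Finset.card_singleton])))
  rcases hcell with hJd | h1 | h2 | h3
  · -- `det J ≥ 0`: only the three cross degrees can be negative
    have h := pivotTwo_posRoots_le_signCell e ![d₁, d₂, d₃] J ![P₁, P₂, Q] hP hd {e + d₁, e + d₂, e + d₃}
      (fun hlt => absurd hJd (not_le.mpr hlt)) (fun k _ => by
        fin_cases k <;> simp)
    exact h.trans (by have := card3 (e + d₁) (e + d₂) (e + d₃); omega)
  · -- `mix(J,P₁) ≥ 0`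
    have h := pivotTwo_posRoots_le_signCell e ![d₁, d₂, d₃] J ![P₁, P₂, Q] hP hd {e + e, e + d₂, e + d₃}
      (fun _ => by simp) (fun k hk => by
        rw [hpair k] at hk
        fin_cases k
        · exact absurd h1 (not_le.mpr (by simpa using hk))
        · simp
        · simp)
    exact h.trans (by have := card3 (e + e) (e + d₂) (e + d₃); omega)
  · -- `mix(J,P₂) ≥ 0`
    have h := pivotTwo_posRoots_le_signCell e ![d₁, d₂, d₃] J ![P₁, P₂, Q] hP hd {e + e, e + d₁, e + d₃}
      (fun _ => by simp) (fun k hk => by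
        rw [hpair k] at hk
        fin_cases k
        · simp
        · exact absurd h2 (not_le.mpr (by simpa using hk))
        · simp)
    exact h.trans (by have := card3 (e + e) (e + d₁) (e + d₃); omega)
  · -- `mix(J,Q) ≥ 0`
    have h := pivotTwo_posRoots_le_signCell e ![d₁, d₂, d₃] J ![P₁, P₂, Q] hP hd {e + e, e + d₁, e + d₂}
      (fun _ => by simp) (fun k hk => by
        rw [hpair k] at hk
        fin_cases k
        · simp
        · simp
        · exact absurd h3 (not_le.mpr (by simpa using hk)))
    exact h.trans (by have := card3 (e + e) (e + d₁) (e + d₂); omega)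

/-- **A seventh root needs the chamber AND the sign cell.**  Combining the sign-cell law with the CHAMBER LAW of
`…WLawTwoChambers` (val-sym-mdr-p1 g4): a `2 × 2` W-configuration has `Z₊ ≤ 6 = 3·2` unless simultaneously
`e + d₂ < 2d₁ ∧ d₁ + e < d₂ + d₃ ∧ d₂ + d₃ < 2e` (gap form `a < g < c < a + g`) and
`det J < 0 ∧ mix(J,P₁) < 0 ∧ mix(J,P₂) < 0 ∧ mix(J,Q) < 0`. -/
theorem wLawTwo_posRoots_le_six_unless_hardCell (hJ : J.IsSymm) (hP₁ : P₁.PosSemidef) (hP₂ : P₂.PosSemidef)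
    (hQ : Q.PosSemidef) (h₂₁ : d₂ < d₁) (h₁ₑ : d₁ < e) (hₑ₃ : e < d₃)
    (h : ¬ ((e + d₂ < 2 * d₁ ∧ d₁ + e < d₂ + d₃ ∧ d₂ + d₃ < 2 * e) ∧
      (J.det < 0 ∧ J 0 0 * P₁ 1 1 + J 1 1 * P₁ 0 0 - 2 * (J 0 1 * P₁ 0 1) < 0
        ∧ J 0 0 * P₂ 1 1 + J 1 1 * P₂ 0 0 - 2 * (J 0 1 * P₂ 0 1) < 0
        ∧ J 0 0 * Q 1 1 + J 1 1 * Q 0 0 - 2 * (J 0 1 * Q 0 1) < 0))) :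
    ((Matrix.det (((X : ℝ[X]) ^ e) • J.map Polynomial.C + ((X : ℝ[X]) ^ d₁) • P₁.map Polynomial.C
        + ((X : ℝ[X]) ^ d₂) • P₂.map Polynomial.C + ((X : ℝ[X]) ^ d₃) • Q.map Polynomial.C)).roots.toFinset.filter
          (fun t => 0 < t)).card ≤ 6 := by
  by_cases hch : e + d₂ < 2 * d₁ ∧ d₁ + e < d₂ + d₃ ∧ d₂ + d₃ < 2 * e
  · have hcell : 0 ≤ J.det ∨ 0 ≤ J 0 0 * P₁ 1 1 + J 1 1 * P₁ 0 0 - 2 * (J 0 1 * P₁ 0 1)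
        ∨ 0 ≤ J 0 0 * P₂ 1 1 + J 1 1 * P₂ 0 0 - 2 * (J 0 1 * P₂ 0 1)
        ∨ 0 ≤ J 0 0 * Q 1 1 + J 1 1 * Q 0 0 - 2 * (J 0 1 * Q 0 1) := by
      by_contra hnot
      push Not at hnot
      exact h ⟨hch, hnot.1, hnot.2.1, hnot.2.2.1, hnot.2.2.2⟩
    exact wLawTwo_posRoots_le_six_of_offCell hJ hP₁ hP₂ hQ h₂₁ h₁ₑ hₑ₃ hcell
  · exact WLawTwoChambers.wLawTwo_posRoots_le_six_of_not_chamber hP₁ hP₂ hQ h₂₁ h₁ₑ hₑ₃ hch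

/-- **The tree's six-root witness is off the sign cell**: for `WLawTwoWitness` (`J = [[620, −260], [−260, −2720]]`,
`P₁ = v vᵀ`, `v = (20, 38)`) one has `mix(J, P₁) = 620·1444 + (−2720)·400 − 2·(−260)·760 = 202480 > 0`; by
`wLawTwo_posRoots_le_six_of_offCell` the witness is extremal in its sign cell (`6 = 2·3`). -/
theorem witness_offCell :
    0 < (!![620, -260; -260, -2720] : Matrix (Fin 2) (Fin 2) ℝ) 0 0
          * (Matrix.vecMulVec ![(20 : ℝ), 38] ![(20 : ℝ), 38] : Matrix (Fin 2) (Fin 2) ℝ) 1 1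
        + (!![620, -260; -260, -2720] : Matrix (Fin 2) (Fin 2) ℝ) 1 1
          * (Matrix.vecMulVec ![(20 : ℝ), 38] ![(20 : ℝ), 38] : Matrix (Fin 2) (Fin 2) ℝ) 0 0
        - 2 * ((!![620, -260; -260, -2720] : Matrix (Fin 2) (Fin 2) ℝ) 0 1
          * (Matrix.vecMulVec ![(20 : ℝ), 38] ![(20 : ℝ), 38] : Matrix (Fin 2) (Fin 2) ℝ) 0 1) := by
  simp [Matrix.vecMulVec_apply]
  norm_num

end WPencil

end WLawTwoSignCell

end Summit.ValiantsHypothesis.ValiantsHypothesis.Theorems.LacunarySymmetroidMatrixDescartes
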